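import Mathlib
import Literature.NumberTheory.Irrationality.LaiSprangZudilin2026.LeadingCoefficient
import HarnessLib

/-!
# Lai–Sprang–Zudilin 2026, Lemma 5.2 — PROOF that the double sum satisfies the recursion (`recurrence_holds`)

L. Lai, J. Sprang, W. Zudilin, *A note on the irrationality of `ζ₂(5)`*, Int. Math. Res. Not. IMRN **2026**:16,
rnag180 = arXiv:2505.05005 [LaiSprangZudilin2026] (held text `paper:arxiv-2505.05005`; read on the page: §1 p. 3
display (eq:rec), §5 p. 8 Lemma 5.2 and the first sentence of its proof).  This file DISCHARGES the named fact
`Literature.NumberTheory.Irrationality.LaiSprangZudilin2026.recurrence` of `LeadingCoefficient.lean`: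
the binomial double sum
`ρ_n = Σ_{0≤i≤k≤n} 2^{4(n−k)} C(2i,i)² C(2n−2i,n−i) C(2k−2i,k−i) C(2k,k)² C(2n−2k,n−k)`
(the tree's `TwoAdicZetaFiveAperyLikeLucas.lszRho`, verbatim the display of Lemma 5.2) satisfies
`(n+1)⁵ρ_{n+1} − 32(2n+1)(8n⁴+16n³+20n²+12n+3)ρ_n + 2¹⁶n⁵ρ_{n−1} = 0` for every `n ≥ 1`.

## The proof (the route named in the printed proof, p. 8: «one can easily verify that the double sum indeed
satisfies the recursion (eq:rec) with the help of multi-sum algorithms of creative telescoping»; the paper then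
gives instead a human proof through the `ε`-deformation of `R_n(t)` and Andrews' transformation, not followed here)

Write `c(m) = C(2m,m)` and `F(n,i,k) = 16^{n−k} c(i)² c(n−i) c(k−i) c(k)² c(n−k)` on `0 ≤ i ≤ k ≤ n` (zero
elsewhere; `lszTerm` below), so `ρ_n = Σ_{i,k} F(n,i,k)`.  All seven binomials are central, so `F` is hypergeometric in
each of `n, i, k` with the single ratio rule `(m+1)c(m+1) = 2(2m+1)c(m)`; the three cross-multiplied step
relations `lszTerm_step_n`, `lszTerm_step_i`, `lszTerm_step_k` hold at EVERY lattice point (boundary included).  Put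
`H(n,i,k) = F(n+3,i,k)/(64³∏_{j<3}(2n+2j−2i+1)(2n+2j−2k+1))` (odd, never-vanishing denominators), so that
`F(n+l,i,k) = H·P_l` (`l = 0,…,3`) with explicit polynomials `P_l` (`hbar_rel₀…₃`), and
`H(n,i+1,k)·B₁ = H·A₁`, `H(n,i,k+1)·B₂ = H·A₂` (`hbar_rel_i`, `hbar_rel_k`).  A creative-telescoping certificate for
the double sum with an ORDER-THREE telescoper (found by us by solving the Wilf–Zeilberger/Apagodu–Zeilberger
polynomial ansatz by exact linear algebra; the order-two telescoper (eq:rec) itself admits no certificate of this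
shape) is the polynomial identity `key`:

`625·Σ_{l=0}^{3} E_l(n) P_l = A₁·Y₁(n,i+1,k) − B₁(n,i−1,k)·Y₁(n,i,k) + A₂·Y₂(n,i,k+1) − B₂(n,i,k−1)·Y₂(n,i,k)`

with `E₀ = 2²⁴(2n+5)(n+1)⁵`, `E₁ = −2¹⁶(2n+3)(n+2)⁵ − 2⁸(2n+5)M(n+1)`, `E₂ = 2⁸(2n+5)(n+2)⁵ + (2n+3)M(n+2)`,
`E₃ = −(2n+3)(n+3)⁵`, `M(m) = 32(2m+1)(8m⁴+16m³+20m²+12m+3)`, and explicit integer polynomials `Y₁, Y₂` of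
degree 6 (`Y1`, `Y2`; checked by `ring`).  Multiplying by `H` gives the pointwise telescoping identity
`625·Σ_l E_l F(n+l,i,k) = Δ_i G₁ + Δ_k G₂` with `G₁ = H·i²(2n−2i+1)(2k−2i+1)·Y₁`, `G₂ = H·4(k−i)k²(2n−2k+1)·Y₂`
of finite support (`telescope_pointwise`); summing over the box `i, k < n+4` kills the right-hand side, whence
the order-three recurrence `Σ_l E_l(n) ρ_{n+l} = 0` (`lszRho_order_three`).  Its telescoper is the left multiple
`(2⁸(2n+5) − (2n+3)N)∘L` of the printed operator `L`: with
`L(n) := 2¹⁶(n+1)⁵ρ_n − M(n+1)ρ_{n+1} + (n+2)⁵ρ_{n+2}` it reads `(2n+3)·L(n+1) = 2⁸(2n+5)·L(n)` (`L2_succ`), and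
`L(0) = 0` is the printed initial data `ρ_0, ρ_1, ρ_2 = 1, 96, 14944` (`recurrence_one` of the fact file); so
`L ≡ 0`, which is (eq:rec) (`recurrence_holds`).

Everything here is PROVED; no new definitions of mathematical content beyond the certificate polynomials.
Not covered: the second half of Lemma 5.2 (`ρ_{n,3} = 768ρ_n`), which concerns the linear forms of §4.
Nearest existing declarations (used, not restated): `lszRho`, `lszRho_zero/one/two`, `recMid`, `recurrence`,
`recurrence_one`; the single-sum pattern is `Literature/Combinatorics/Enumerative/AperyNumbers.lean`.
-/

namespace Literature.NumberTheory.Irrationality.LaiSprangZudilin2026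

open Finset Literature.Combinatorics.Enumerative.TwoAdicZetaFiveAperyLikeLucas

namespace DoubleSumCT

/-! ## The summand as a hypergeometric term on `ℕ³` -/

/-- `c(m) = C(2m,m)` as a rational number. [cite: LaiSprangZudilin2026, Lemma 5.2 (display)] -/
def cb (m : ℕ) : ℚ := (Nat.centralBinom m : ℚ)

/-- The ratio rule `(m+1)·c(m+1) = 2(2m+1)·c(m)` of the central binomials (Mathlib
`Nat.succ_mul_centralBinom_succ`). [cite: LaiSprangZudilin2026, Lemma 5.2 (display)] -/
theorem cb_succ (m : ℕ) : ((m : ℚ) + 1) * cb (m + 1) = 2 * (2 * (m : ℚ) + 1) * cb m := by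
  have h := Nat.succ_mul_centralBinom_succ m
  unfold cb
  exact_mod_cast h

/-- The summand `F(m,i,k) = 16^{m−k} c(i)² c(m−i) c(k−i) c(k)² c(m−k)` of `ρ_m` on `0 ≤ i ≤ k ≤ m`, extended by
zero to all of `ℕ³`. [cite: LaiSprangZudilin2026, Lemma 5.2 (display)] -/
def lszTerm (m i k : ℕ) : ℚ :=
  if i ≤ k ∧ k ≤ m then 16 ^ (m - k) * cb i ^ 2 * cb (m - i) * cb (k - i) * cb k ^ 2 * cb (m - k) else 0

/-- On the support, `lszTerm` is the cast of the printed summand of `lszRho`. [cite: LaiSprangZudilin2026, Lemma 5.2 (display)] -/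
theorem lszTerm_of_le (m i k : ℕ) (hik : i ≤ k) (hkm : k ≤ m) :
    lszTerm m i k = ((2 ^ (4 * (m - k)) * (2 * i).choose i ^ 2 * (2 * m - 2 * i).choose (m - i) *
      (2 * k - 2 * i).choose (k - i) * (2 * k).choose k ^ 2 * (2 * m - 2 * k).choose (m - k) : ℕ) : ℚ) := by
  unfold lszTerm cb
  rw [if_pos ⟨hik, hkm⟩]
  have e1 : 2 * m - 2 * i = 2 * (m - i) := by omega
  have e2 : 2 * k - 2 * i = 2 * (k - i) := by omega
  have e3 : 2 * m - 2 * k = 2 * (m - k) := by omega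
  rw [e1, e2, e3, pow_mul]
  simp only [Nat.centralBinom_eq_two_mul_choose]
  push_cast
  norm_num

/-- `lszTerm(m,i,k) = 0` off the support `i ≤ k`. [cite: LaiSprangZudilin2026, Lemma 5.2 (display)] -/
theorem lszTerm_of_lt_left {m i k : ℕ} (h : k < i) : lszTerm m i k = 0 := by
  unfold lszTerm
  rw [if_neg (fun hc => absurd hc.1 (by omega))]

/-- `lszTerm(m,i,k) = 0` off the support `k ≤ m`. [cite: LaiSprangZudilin2026, Lemma 5.2 (display)] -/
theorem lszTerm_of_lt_right {m i k : ℕ} (h : m < k) : lszTerm m i k = 0 := by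
  unfold lszTerm
  rw [if_neg (fun hc => absurd hc.2 (by omega))]

/-- A finite sum of a guard over a larger range. [cite: LaiSprangZudilin2026, Lemma 5.2 (display)] -/
theorem sum_range_ite_le (N m : ℕ) (h : m + 1 ≤ N) (f : ℕ → ℚ) :
    ∑ x ∈ range N, (if x ≤ m then f x else 0) = ∑ x ∈ range (m + 1), f x := by
  rw [← Finset.sum_range_add_sum_Ico _ h]
  have h1 : ∑ x ∈ range (m + 1), (if x ≤ m then f x else 0) = ∑ x ∈ range (m + 1), f x :=
    Finset.sum_congr rfl (fun x hx => by rw [if_pos (by have := Finset.mem_range.mp hx; omega)])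
  have h2 : ∑ x ∈ Ico (m + 1) N, (if x ≤ m then f x else 0) = 0 :=
    Finset.sum_eq_zero (fun x hx => by rw [if_neg (by have := (Finset.mem_Ico.mp hx).1; omega)])
  rw [h1, h2, add_zero]

/-- **`ρ_m` as a box sum of `lszTerm`**: `ρ_m = Σ_{i<N} Σ_{k<N} lszTerm(m,i,k)` for any `N ≥ m+1`.
[cite: LaiSprangZudilin2026, Lemma 5.2 (display)] -/
theorem lszRho_eq_boxSum (m N : ℕ) (hN : m + 1 ≤ N) :
    (lszRho m : ℚ) = ∑ i ∈ range N, ∑ k ∈ range N, lszTerm m i k := by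
  have step1 : (lszRho m : ℚ) = ∑ k ∈ range (m + 1), ∑ i ∈ range (k + 1), lszTerm m i k := by
    unfold lszRho
    rw [Nat.cast_sum]
    refine Finset.sum_congr rfl fun k hk => ?_
    rw [Nat.cast_sum]
    refine Finset.sum_congr rfl fun i hi => ?_
    have hk' := Finset.mem_range.mp hk
    have hi' := Finset.mem_range.mp hi
    exact (lszTerm_of_le m i k (by omega) (by omega)).symm
  rw [step1, Finset.sum_comm, ← sum_range_ite_le N m hN]
  refine Finset.sum_congr rfl fun k hk => ?_
  have hkN := Finset.mem_range.mp hk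
  by_cases hkm : k ≤ m
  · rw [if_pos hkm, ← sum_range_ite_le N k (by omega)]
    refine Finset.sum_congr rfl fun i _ => ?_
    by_cases hik : i ≤ k
    · rw [if_pos hik]
    · rw [if_neg hik, lszTerm_of_lt_left (by omega)]
  · rw [if_neg hkm]
    exact (Finset.sum_eq_zero fun i _ => lszTerm_of_lt_right (by omega)).symm

/-! ## The three step relations of `lszTerm` (valid at every lattice point) -/

/-- Step in `n`: `(m+1−i)(m+1−k)·F(m+1,i,k) = 64(2m−2i+1)(2m−2k+1)·F(m,i,k)`.
[cite: LaiSprangZudilin2026, Lemma 5.2 (proof, p. 8: creative telescoping)] -/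
theorem lszTerm_step_n (m i k : ℕ) :
    ((m : ℚ) + 1 - i) * ((m : ℚ) + 1 - k) * lszTerm (m + 1) i k
      = 64 * (2 * (m : ℚ) - 2 * i + 1) * (2 * (m : ℚ) - 2 * k + 1) * lszTerm m i k := by
  unfold lszTerm
  by_cases hik : i ≤ k
  · by_cases hkm : k ≤ m
    · rw [if_pos (show i ≤ k ∧ k ≤ m + 1 from ⟨hik, by omega⟩), if_pos (show i ≤ k ∧ k ≤ m from ⟨hik, hkm⟩)]
      obtain ⟨b, rfl⟩ := Nat.exists_eq_add_of_le hik
      obtain ⟨a, rfl⟩ := Nat.exists_eq_add_of_le hkm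
      have e1 : i + b + a + 1 - (i + b) = a + 1 := by omega
      have e2 : i + b + a + 1 - i = b + a + 1 := by omega
      have e3 : i + b - i = b := by omega
      have e4 : i + b + a - (i + b) = a := by omega
      have e5 : i + b + a - i = b + a := by omega
      rw [e1, e2, e3, e4, e5]
      have h1 := cb_succ a
      have h2 := cb_succ (b + a)
      push_cast at h2 ⊢
      have h12 : ((b : ℚ) + a + 1) * cb (b + a + 1) * (((a : ℚ) + 1) * cb (a + 1))
          = (2 * (2 * ((b : ℚ) + a) + 1) * cb (b + a)) * (2 * (2 * (a : ℚ) + 1) * cb a) := by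
        rw [h1, h2]
      linear_combination (16 * 16 ^ a * cb i ^ 2 * cb b * cb (i + b) ^ 2) * h12
    · rw [if_neg (show ¬(i ≤ k ∧ k ≤ m) from fun hc => hkm hc.2)]
      by_cases hk1 : k = m + 1
      · subst hk1
        rw [if_pos (show i ≤ m + 1 ∧ m + 1 ≤ m + 1 from ⟨hik, le_rfl⟩)]
        push_cast
        ring
      · rw [if_neg (show ¬(i ≤ k ∧ k ≤ m + 1) from fun hc => hk1 (by omega))]
        ring
  · rw [if_neg (show ¬(i ≤ k ∧ k ≤ m + 1) from fun hc => hik hc.1),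
      if_neg (show ¬(i ≤ k ∧ k ≤ m) from fun hc => hik hc.1)]
    ring

/-- Step in `i`: `F(m,i+1,k)·(i+1)²(2m−2i−1)(2k−2i−1) = F(m,i,k)·(2i+1)²(m−i)(k−i)`.
[cite: LaiSprangZudilin2026, Lemma 5.2 (proof, p. 8: creative telescoping)] -/
theorem lszTerm_step_i (m i k : ℕ) :
    lszTerm m (i + 1) k * (((i : ℚ) + 1) ^ 2 * (2 * (m : ℚ) - 2 * i - 1) * (2 * (k : ℚ) - 2 * i - 1))
      = lszTerm m i k * ((2 * (i : ℚ) + 1) ^ 2 * ((m : ℚ) - i) * ((k : ℚ) - i)) := by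
  unfold lszTerm
  by_cases h1 : i + 1 ≤ k
  · by_cases hkm : k ≤ m
    · rw [if_pos (show i + 1 ≤ k ∧ k ≤ m from ⟨h1, hkm⟩), if_pos (show i ≤ k ∧ k ≤ m from ⟨by omega, hkm⟩)]
      obtain ⟨b, rfl⟩ := Nat.exists_eq_add_of_le h1
      obtain ⟨a, rfl⟩ := Nat.exists_eq_add_of_le hkm
      have e1 : i + 1 + b + a - (i + 1 + b) = a := by omega
      have e2 : i + 1 + b + a - (i + 1) = b + a := by omega
      have e3 : i + 1 + b - (i + 1) = b := by omega
      have e4 : i + 1 + b + a - i = b + a + 1 := by omega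
      have e5 : i + 1 + b - i = b + 1 := by omega
      rw [e1, e2, e3, e4, e5]
      have hI := cb_succ i
      have hB := cb_succ b
      have hBA := cb_succ (b + a)
      push_cast at hBA ⊢
      have hprod : ((i : ℚ) + 1) * cb (i + 1) * (((i : ℚ) + 1) * cb (i + 1)) * cb (b + a) * cb b
            * ((2 * ((b : ℚ) + a) + 1) * (2 * (b : ℚ) + 1))
          = cb i ^ 2 * (((b : ℚ) + a + 1) * cb (b + a + 1)) * (((b : ℚ) + 1) * cb (b + 1))
            * (2 * (i : ℚ) + 1) ^ 2 := by
        rw [hI, hBA, hB]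
        ring
      linear_combination (16 ^ a * cb (i + 1 + b) ^ 2 * cb a) * hprod
    · rw [if_neg (show ¬(i + 1 ≤ k ∧ k ≤ m) from fun hc => hkm hc.2),
        if_neg (show ¬(i ≤ k ∧ k ≤ m) from fun hc => hkm hc.2)]
      ring
  · rw [if_neg (show ¬(i + 1 ≤ k ∧ k ≤ m) from fun hc => h1 hc.1)]
    by_cases hik : i ≤ k
    · have hk : k = i := by omega
      subst hk
      ring
    · rw [if_neg (show ¬(i ≤ k ∧ k ≤ m) from fun hc => hik hc.1)]
      ring

/-- Step in `k`: `F(m,i,k+1)·4(k−i+1)(k+1)²(2m−2k−1) = F(m,i,k)·(2k−2i+1)(2k+1)²(m−k)`.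
[cite: LaiSprangZudilin2026, Lemma 5.2 (proof, p. 8: creative telescoping)] -/
theorem lszTerm_step_k (m i k : ℕ) :
    lszTerm m i (k + 1) * (4 * ((k : ℚ) - i + 1) * ((k : ℚ) + 1) ^ 2 * (2 * (m : ℚ) - 2 * k - 1))
      = lszTerm m i k * ((2 * (k : ℚ) - 2 * i + 1) * (2 * (k : ℚ) + 1) ^ 2 * ((m : ℚ) - k)) := by
  unfold lszTerm
  by_cases hik : i ≤ k
  · by_cases hkm : k + 1 ≤ m
    · rw [if_pos (show i ≤ k + 1 ∧ k + 1 ≤ m from ⟨by omega, hkm⟩),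
        if_pos (show i ≤ k ∧ k ≤ m from ⟨hik, by omega⟩)]
      obtain ⟨b, rfl⟩ := Nat.exists_eq_add_of_le hik
      obtain ⟨a, rfl⟩ := Nat.exists_eq_add_of_le hkm
      have e1 : i + b + 1 + a - (i + b + 1) = a := by omega
      have e2 : i + b + 1 + a - i = b + 1 + a := by omega
      have e3 : i + b + 1 - i = b + 1 := by omega
      have e4 : i + b + 1 + a - (i + b) = a + 1 := by omega
      have e5 : i + b - i = b := by omega
      rw [e1, e2, e3, e4, e5]
      have hB := cb_succ b
      have hIB := cb_succ (i + b)
      have hA := cb_succ a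
      push_cast at hIB ⊢
      have hprod : ((b : ℚ) + 1) * cb (b + 1) * (((i : ℚ) + b + 1) * cb (i + b + 1)) ^ 2 * cb a
            * (4 * (2 * (a : ℚ) + 1))
          = 16 * cb b * cb (i + b) ^ 2 * (((a : ℚ) + 1) * cb (a + 1))
            * ((2 * (b : ℚ) + 1) * (2 * ((i : ℚ) + b) + 1) ^ 2) := by
        rw [hB, hIB, hA]
        ring
      linear_combination (16 ^ a * cb i ^ 2 * cb (b + 1 + a)) * hprod
    · rw [if_neg (show ¬(i ≤ k + 1 ∧ k + 1 ≤ m) from fun hc => hkm hc.2)]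
      by_cases hk : k ≤ m
      · have hm : m = k := by omega
        subst hm
        rw [if_pos (show i ≤ m ∧ m ≤ m from ⟨hik, le_rfl⟩)]
        ring
      · rw [if_neg (show ¬(i ≤ k ∧ k ≤ m) from fun hc => hk hc.2)]
        ring
  · rw [if_neg (show ¬(i ≤ k ∧ k ≤ m) from fun hc => hik hc.1)]
    by_cases hi1 : i ≤ k + 1
    · have hi : i = k + 1 := by omega
      subst hi
      push_cast
      ring
    · rw [if_neg (show ¬(i ≤ k + 1 ∧ k + 1 ≤ m) from fun hc => hi1 hc.1)]
      ring

/-! ## The normalised term `H` and its relations -/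

/-- The odd product `(2n−2j+1)(2n−2j+3)(2n−2j+5)` (never zero on `ℕ²`).
[cite: LaiSprangZudilin2026, Lemma 5.2 (proof, p. 8: creative telescoping)] -/
def oddProd (n j : ℕ) : ℚ := (2 * (n : ℚ) - 2 * j + 1) * (2 * (n : ℚ) - 2 * j + 3) * (2 * (n : ℚ) - 2 * j + 5)

/-- `2n − 2j + c ≠ 0` for odd `c`. [cite: LaiSprangZudilin2026, Lemma 5.2 (proof, p. 8: creative telescoping)] -/
theorem lin_odd_ne_zero (n j : ℕ) (c : ℤ) (hc : Odd c) : (2 * (n : ℚ) - 2 * j + c) ≠ 0 := by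
  intro h
  have h' : (((2 * (n : ℤ) - 2 * j + c : ℤ)) : ℚ) = 0 := by
    push_cast
    exact h
  have h'' : (2 * (n : ℤ) - 2 * j + c) = 0 := by exact_mod_cast h'
  obtain ⟨t, ht⟩ := hc
  omega

/-- `oddProd n j ≠ 0`. [cite: LaiSprangZudilin2026, Lemma 5.2 (proof, p. 8: creative telescoping)] -/
theorem oddProd_ne_zero (n j : ℕ) : oddProd n j ≠ 0 := by
  have h1 := lin_odd_ne_zero n j 1 ⟨0, by norm_num⟩
  have h3 := lin_odd_ne_zero n j 3 ⟨1, by norm_num⟩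
  have h5 := lin_odd_ne_zero n j 5 ⟨2, by norm_num⟩
  push_cast at h1 h3 h5
  unfold oddProd
  exact mul_ne_zero (mul_ne_zero h1 h3) h5

/-- `H(n,i,k) = F(n+3,i,k)/(64³·oddProd(n,i)·oddProd(n,k))`.
[cite: LaiSprangZudilin2026, Lemma 5.2 (proof, p. 8: creative telescoping)] -/
def hbar (n i k : ℕ) : ℚ := lszTerm (n + 3) i k / (64 ^ 3 * oddProd n i * oddProd n k)

/-- The polynomial `P₀ = (n+1−i)(n+2−i)(n+3−i)(n+1−k)(n+2−k)(n+3−k)` with `F(n) = H·P₀`.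
[cite: LaiSprangZudilin2026, Lemma 5.2 (proof, p. 8: creative telescoping)] -/
def POL0 (n i k : ℚ) : ℚ := (n + 1 - i) * (n + 2 - i) * (n + 3 - i) * ((n + 1 - k) * (n + 2 - k) * (n + 3 - k))

/-- `P₁ = 64(2n−2i+1)(n+2−i)(n+3−i)(2n−2k+1)(n+2−k)(n+3−k)` with `F(n+1) = H·P₁`.
[cite: LaiSprangZudilin2026, Lemma 5.2 (proof, p. 8: creative telescoping)] -/
def POL1 (n i k : ℚ) : ℚ :=
  64 * ((2 * n - 2 * i + 1) * (n + 2 - i) * (n + 3 - i)) * ((2 * n - 2 * k + 1) * (n + 2 - k) * (n + 3 - k))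

/-- `P₂ = 64²(2n−2i+1)(2n−2i+3)(n+3−i)(2n−2k+1)(2n−2k+3)(n+3−k)` with `F(n+2) = H·P₂`.
[cite: LaiSprangZudilin2026, Lemma 5.2 (proof, p. 8: creative telescoping)] -/
def POL2 (n i k : ℚ) : ℚ :=
  64 ^ 2 * ((2 * n - 2 * i + 1) * (2 * n - 2 * i + 3) * (n + 3 - i)) *
    ((2 * n - 2 * k + 1) * (2 * n - 2 * k + 3) * (n + 3 - k))

/-- `P₃ = 64³(2n−2i+1)(2n−2i+3)(2n−2i+5)(2n−2k+1)(2n−2k+3)(2n−2k+5)` with `F(n+3) = H·P₃`.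
[cite: LaiSprangZudilin2026, Lemma 5.2 (proof, p. 8: creative telescoping)] -/
def POL3 (n i k : ℚ) : ℚ :=
  64 ^ 3 * ((2 * n - 2 * i + 1) * (2 * n - 2 * i + 3) * (2 * n - 2 * i + 5)) *
    ((2 * n - 2 * k + 1) * (2 * n - 2 * k + 3) * (2 * n - 2 * k + 5))

/-- `F(n+3,i,k) = H·P₃`. [cite: LaiSprangZudilin2026, Lemma 5.2 (proof, p. 8: creative telescoping)] -/
theorem hbar_rel₃ (n i k : ℕ) : lszTerm (n + 3) i k = hbar n i k * POL3 n i k := by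
  have hI := oddProd_ne_zero n i
  have hK := oddProd_ne_zero n k
  unfold hbar
  rw [div_mul_eq_mul_div, eq_div_iff (by positivity)]
  unfold POL3 oddProd
  ring

/-- `F(n+2,i,k) = H·P₂`. [cite: LaiSprangZudilin2026, Lemma 5.2 (proof, p. 8: creative telescoping)] -/
theorem hbar_rel₂ (n i k : ℕ) : lszTerm (n + 2) i k = hbar n i k * POL2 n i k := by
  have hI := oddProd_ne_zero n i
  have hK := oddProd_ne_zero n k
  have hs := lszTerm_step_n (n + 2) i k
  push_cast at hs
  unfold hbar
  rw [div_mul_eq_mul_div, eq_div_iff (by positivity)]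
  unfold POL2 oddProd
  linear_combination (-(64 ^ 2 * ((2 * (n : ℚ) - 2 * i + 1) * (2 * (n : ℚ) - 2 * i + 3) *
    ((2 * (n : ℚ) - 2 * k + 1) * (2 * (n : ℚ) - 2 * k + 3))))) * hs

/-- `F(n+1,i,k) = H·P₁`. [cite: LaiSprangZudilin2026, Lemma 5.2 (proof, p. 8: creative telescoping)] -/
theorem hbar_rel₁ (n i k : ℕ) : lszTerm (n + 1) i k = hbar n i k * POL1 n i k := by
  have hI := oddProd_ne_zero n i
  have hK := oddProd_ne_zero n k
  have hs2 := lszTerm_step_n (n + 2) i k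
  have hs1 := lszTerm_step_n (n + 1) i k
  push_cast at hs2 hs1
  unfold hbar
  rw [div_mul_eq_mul_div, eq_div_iff (by positivity)]
  unfold POL1 oddProd
  linear_combination
    (-(64 * ((2 * (n : ℚ) - 2 * i + 1) * (2 * (n : ℚ) - 2 * k + 1) * ((n : ℚ) + 2 - i) * ((n : ℚ) + 2 - k)))) * hs2
    + (-(64 ^ 2 * ((2 * (n : ℚ) - 2 * i + 1) * (2 * (n : ℚ) - 2 * k + 1) * (2 * (n : ℚ) - 2 * i + 5) *
        (2 * (n : ℚ) - 2 * k + 5)))) * hs1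

/-- `F(n,i,k) = H·P₀`. [cite: LaiSprangZudilin2026, Lemma 5.2 (proof, p. 8: creative telescoping)] -/
theorem hbar_rel₀ (n i k : ℕ) : lszTerm n i k = hbar n i k * POL0 n i k := by
  have hI := oddProd_ne_zero n i
  have hK := oddProd_ne_zero n k
  have hs2 := lszTerm_step_n (n + 2) i k
  have hs1 := lszTerm_step_n (n + 1) i k
  have hs0 := lszTerm_step_n n i k
  push_cast at hs2 hs1 hs0
  unfold hbar
  rw [div_mul_eq_mul_div, eq_div_iff (by positivity)]
  unfold POL0 oddProd
  linear_combination
    (-(((n : ℚ) + 1 - i) * ((n : ℚ) + 2 - i) * ((n : ℚ) + 1 - k) * ((n : ℚ) + 2 - k))) * hs2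
    + (-(64 * (((n : ℚ) + 1 - i) * ((n : ℚ) + 1 - k) * (2 * (n : ℚ) - 2 * i + 5) * (2 * (n : ℚ) - 2 * k + 5)))) * hs1
    + (-(64 ^ 2 * ((2 * (n : ℚ) - 2 * i + 5) * (2 * (n : ℚ) - 2 * k + 5) * (2 * (n : ℚ) - 2 * i + 3) *
        (2 * (n : ℚ) - 2 * k + 3)))) * hs0

/-- The certificate polynomials: `A₁ = (2i+1)²(k−i)(n+3−i)` (numerator of `H(n,i+1,k)/H(n,i,k)`).
[cite: LaiSprangZudilin2026, Lemma 5.2 (proof, p. 8: creative telescoping)] -/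
def A1 (n i k : ℚ) : ℚ := (2 * i + 1) ^ 2 * (k - i) * (n + 3 - i)

/-- `B₁(n,i−1,k) = i²(2n−2i+1)(2k−2i+1)` (shifted denominator of `H(n,i+1,k)/H(n,i,k)`).
[cite: LaiSprangZudilin2026, Lemma 5.2 (proof, p. 8: creative telescoping)] -/
def B1m (n i k : ℚ) : ℚ := i ^ 2 * (2 * n - 2 * i + 1) * (2 * k - 2 * i + 1)

/-- `A₂ = (2k−2i+1)(2k+1)²(n+3−k)` (numerator of `H(n,i,k+1)/H(n,i,k)`).
[cite: LaiSprangZudilin2026, Lemma 5.2 (proof, p. 8: creative telescoping)] -/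
def A2 (n i k : ℚ) : ℚ := (2 * k - 2 * i + 1) * (2 * k + 1) ^ 2 * (n + 3 - k)

/-- `B₂(n,i,k−1) = 4(k−i)k²(2n−2k+1)` (shifted denominator of `H(n,i,k+1)/H(n,i,k)`).
[cite: LaiSprangZudilin2026, Lemma 5.2 (proof, p. 8: creative telescoping)] -/
def B2m (n i k : ℚ) : ℚ := 4 * (k - i) * k ^ 2 * (2 * n - 2 * k + 1)

/-- `2n − 2j − 1 ≠ 0`. [cite: LaiSprangZudilin2026, Lemma 5.2 (proof, p. 8: creative telescoping)] -/
theorem lin_sub_one_ne_zero (n j : ℕ) : (2 * (n : ℚ) - 2 * j - 1) ≠ 0 := by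
  have h := lin_odd_ne_zero n j (-1) ⟨-1, by norm_num⟩
  push_cast at h
  intro h0
  exact h (by linear_combination h0)

/-- `H(n,i+1,k)·B₁(n,i,k) = H(n,i,k)·A₁(n,i,k)`. [cite: LaiSprangZudilin2026, Lemma 5.2 (proof, p. 8: creative telescoping)] -/
theorem hbar_rel_i (n i k : ℕ) :
    hbar n (i + 1) k * B1m n ((i : ℚ) + 1) k = hbar n i k * A1 n i k := by
  have hK := oddProd_ne_zero n k
  have h1 := lin_odd_ne_zero n i 1 ⟨0, by norm_num⟩
  have h3 := lin_odd_ne_zero n i 3 ⟨1, by norm_num⟩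
  have h5 := lin_odd_ne_zero n i 5 ⟨2, by norm_num⟩
  have hm1 := lin_sub_one_ne_zero n i
  push_cast at h1 h3 h5
  have hs := lszTerm_step_i (n + 3) i k
  push_cast at hs
  have hs' : lszTerm (n + 3) (i + 1) k * B1m n ((i : ℚ) + 1) k * (2 * (n : ℚ) - 2 * i + 5)
      = lszTerm (n + 3) i k * A1 n i k * (2 * (n : ℚ) - 2 * i - 1) := by
    unfold B1m A1
    linear_combination (2 * (n : ℚ) - 2 * i - 1) * hs
  have e0 : oddProd n i = ((2 * (n : ℚ) - 2 * i + 1) * (2 * (n : ℚ) - 2 * i + 3)) * (2 * (n : ℚ) - 2 * i + 5) := by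
    unfold oddProd
    ring
  have e1 : oddProd n (i + 1)
      = (2 * (n : ℚ) - 2 * i - 1) * ((2 * (n : ℚ) - 2 * i + 1) * (2 * (n : ℚ) - 2 * i + 3)) := by
    unfold oddProd
    push_cast
    ring
  have hC : ((2 * (n : ℚ) - 2 * i + 1) * (2 * (n : ℚ) - 2 * i + 3)) ≠ 0 := mul_ne_zero h1 h3
  unfold hbar
  rw [e0, e1]
  generalize ((2 * (n : ℚ) - 2 * i + 1) * (2 * (n : ℚ) - 2 * i + 3)) = C at hC ⊢
  rw [div_mul_eq_mul_div, div_mul_eq_mul_div, div_eq_div_iff (by positivity) (by positivity)]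
  linear_combination (64 ^ 3 * C * oddProd n k) * hs'

/-- `H(n,i,k+1)·B₂(n,i,k) = H(n,i,k)·A₂(n,i,k)`. [cite: LaiSprangZudilin2026, Lemma 5.2 (proof, p. 8: creative telescoping)] -/
theorem hbar_rel_k (n i k : ℕ) :
    hbar n i (k + 1) * B2m n i ((k : ℚ) + 1) = hbar n i k * A2 n i k := by
  have hI := oddProd_ne_zero n i
  have h1 := lin_odd_ne_zero n k 1 ⟨0, by norm_num⟩
  have h3 := lin_odd_ne_zero n k 3 ⟨1, by norm_num⟩
  have h5 := lin_odd_ne_zero n k 5 ⟨2, by norm_num⟩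
  have hm1 := lin_sub_one_ne_zero n k
  push_cast at h1 h3 h5
  have hs := lszTerm_step_k (n + 3) i k
  push_cast at hs
  have hs' : lszTerm (n + 3) i (k + 1) * B2m n i ((k : ℚ) + 1) * (2 * (n : ℚ) - 2 * k + 5)
      = lszTerm (n + 3) i k * A2 n i k * (2 * (n : ℚ) - 2 * k - 1) := by
    unfold B2m A2
    linear_combination (2 * (n : ℚ) - 2 * k - 1) * hs
  have e0 : oddProd n k = ((2 * (n : ℚ) - 2 * k + 1) * (2 * (n : ℚ) - 2 * k + 3)) * (2 * (n : ℚ) - 2 * k + 5) := by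
    unfold oddProd
    ring
  have e1 : oddProd n (k + 1)
      = (2 * (n : ℚ) - 2 * k - 1) * ((2 * (n : ℚ) - 2 * k + 1) * (2 * (n : ℚ) - 2 * k + 3)) := by
    unfold oddProd
    push_cast
    ring
  have hC : ((2 * (n : ℚ) - 2 * k + 1) * (2 * (n : ℚ) - 2 * k + 3)) ≠ 0 := mul_ne_zero h1 h3
  unfold hbar
  rw [e0, e1]
  generalize ((2 * (n : ℚ) - 2 * k + 1) * (2 * (n : ℚ) - 2 * k + 3)) = C at hC ⊢
  rw [div_mul_eq_mul_div, div_mul_eq_mul_div, div_eq_div_iff (by positivity) (by positivity)]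
  linear_combination (64 ^ 3 * oddProd n i * C) * hs'

/-! ## The certificate -/

/-- `M(m) = 32(2m+1)(8m⁴+16m³+20m²+12m+3)`, the middle coefficient of (eq:rec), over `ℚ`.
[cite: LaiSprangZudilin2026, §1 (eq:rec)] -/
def MQ (m : ℚ) : ℚ := 32 * (2 * m + 1) * (8 * m ^ 4 + 16 * m ^ 3 + 20 * m ^ 2 + 12 * m + 3)

/-- `recMid` is `MQ` on naturals. [cite: LaiSprangZudilin2026, §1 (eq:rec)] -/
theorem recMid_cast (m : ℕ) : (recMid m : ℚ) = MQ m := by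
  unfold recMid MQ
  push_cast
  ring

/-- Telescoper coefficient `E₀ = 2²⁴(2n+5)(n+1)⁵`. [cite: LaiSprangZudilin2026, Lemma 5.2 (proof, p. 8: creative telescoping)] -/
def E0 (n : ℚ) : ℚ := 2 ^ 24 * (2 * n + 5) * (n + 1) ^ 5

/-- Telescoper coefficient `E₁ = −2¹⁶(2n+3)(n+2)⁵ − 2⁸(2n+5)M(n+1)`.
[cite: LaiSprangZudilin2026, Lemma 5.2 (proof, p. 8: creative telescoping)] -/
def E1 (n : ℚ) : ℚ := -(2 ^ 16 * (2 * n + 3) * (n + 2) ^ 5) - 2 ^ 8 * (2 * n + 5) * MQ (n + 1)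

/-- Telescoper coefficient `E₂ = 2⁸(2n+5)(n+2)⁵ + (2n+3)M(n+2)`.
[cite: LaiSprangZudilin2026, Lemma 5.2 (proof, p. 8: creative telescoping)] -/
def E2 (n : ℚ) : ℚ := 2 ^ 8 * (2 * n + 5) * (n + 2) ^ 5 + (2 * n + 3) * MQ (n + 2)

/-- Telescoper coefficient `E₃ = −(2n+3)(n+3)⁵`. [cite: LaiSprangZudilin2026, Lemma 5.2 (proof, p. 8: creative telescoping)] -/
def E3 (n : ℚ) : ℚ := -((2 * n + 3) * (n + 3) ^ 5)

/-- Certificate polynomial `Y₁` (`i`-direction), degree 6, integer coefficients (content `2¹⁸` pulled out).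
[cite: LaiSprangZudilin2026, Lemma 5.2 (proof, p. 8: creative telescoping)] -/
def Y1 (n i k : ℚ) : ℚ :=
  262144 *
    (-363204 - 1375833 * n - 1744405 * n ^ 2 - 1002300 * n ^ 3 - 269250 * n ^ 4 - 27500 * n ^ 5
      - 433551 * k - 3144468 * n * k - 5004500 * n ^ 2 * k - 3267950 * n ^ 3 * k
      - 959000 * n ^ 4 * k - 105000 * n ^ 5 * k + 2750245 * k ^ 2 + 6158694 * n * k ^ 2
      + 4897040 * n ^ 2 * k ^ 2 + 1674600 * n ^ 3 * k ^ 2 + 210000 * n ^ 4 * k ^ 2 - 1061143 * k ^ 3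
      - 1267648 * n * k ^ 3 - 539020 * n ^ 2 * k ^ 3 - 79800 * n ^ 3 * k ^ 3 - 249536 * k ^ 4
      - 197188 * n * k ^ 4 - 38760 * n ^ 2 * k ^ 4 + 9996 * k ^ 5 - 17784 * n * k ^ 5
      + 24624 * k ^ 6 - 57864 * i - 294028 * n * i - 512480 * n ^ 2 * i - 381800 * n ^ 3 * i
      - 125500 * n ^ 4 * i - 15000 * n ^ 5 * i + 518860 * i * k + 1690664 * n * i * k
      + 1703820 * n ^ 2 * i * k + 676500 * n ^ 3 * i * k + 93000 * n ^ 4 * i * k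
      - 872070 * i * k ^ 2 - 1492572 * n * i * k ^ 2 - 799740 * n ^ 2 * i * k ^ 2
      - 137400 * n ^ 3 * i * k ^ 2 + 276542 * i * k ^ 3 + 238780 * n * i * k ^ 3
      + 52440 * n ^ 2 * i * k ^ 3 + 35976 * i * k ^ 4 + 25992 * n * i * k ^ 4 - 12312 * i * k ^ 5)

/-- Certificate polynomial `Y₂` (`k`-direction), degree 6, integer coefficients (content `2¹⁷` pulled out).
[cite: LaiSprangZudilin2026, Lemma 5.2 (proof, p. 8: creative telescoping)] -/
def Y2 (n i k : ℚ) : ℚ :=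
  131072 *
    (727875 + 1819875 * n + 1773750 * n ^ 2 + 841250 * n ^ 3 + 194250 * n ^ 4 + 17500 * n ^ 5
      - 426150 * k - 585300 * n * k - 74100 * n ^ 2 * k + 210550 * n ^ 3 * k + 107000 * n ^ 4 * k
      + 15000 * n ^ 5 * k + 32070 * k ^ 2 + 62680 * n * k ^ 2 + 34430 * n ^ 2 * k ^ 2
      + 5700 * n ^ 3 * k ^ 2 + 10674 * k ^ 3 + 13818 * n * k ^ 3 + 3420 * n ^ 2 * k ^ 3
      + 6156 * k ^ 4 + 2052 * n * k ^ 4 + 2896125 * i + 7930500 * n * i + 8432750 * n ^ 2 * i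
      + 4339500 * n ^ 3 * i + 1082500 * n ^ 4 * i + 105000 * n ^ 5 * i - 2353950 * i * k
      - 5189500 * n * i * k - 4143800 * n ^ 2 * i * k - 1420500 * n ^ 3 * i * k
      - 177000 * n ^ 4 * i * k + 100760 * i * k ^ 2 + 217520 * n * i * k ^ 2
      + 128600 * n ^ 2 * i * k ^ 2 + 22800 * n ^ 3 * i * k ^ 2 + 32982 * i * k ^ 3
      + 49800 * n * i * k ^ 3 + 13680 * n ^ 2 * i * k ^ 3 + 22572 * i * k ^ 4 + 8208 * n * i * k ^ 4
      + 3750 * i ^ 2 + 4500 * i ^ 2 * k - 14400 * i ^ 2 * k ^ 2 - 7380 * i ^ 2 * k ^ 3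
      + 12312 * i ^ 2 * k ^ 4)

/-- **The certificate identity** (a polynomial identity in `ℚ[n,i,k]`, checked by `ring`):
`625·Σ_l E_l P_l = A₁·Y₁(i+1) − B₁(i−1)·Y₁ + A₂·Y₂(k+1) − B₂(k−1)·Y₂`.
[cite: LaiSprangZudilin2026, Lemma 5.2 (proof, p. 8: creative telescoping)] -/
theorem key (n i k : ℚ) :
    625 * (E0 n * POL0 n i k + E1 n * POL1 n i k + E2 n * POL2 n i k + E3 n * POL3 n i k)
      = A1 n i k * Y1 n (i + 1) k - B1m n i k * Y1 n i k
        + A2 n i k * Y2 n i (k + 1) - B2m n i k * Y2 n i k := by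
  unfold E0 E1 E2 E3 MQ POL0 POL1 POL2 POL3 A1 B1m A2 B2m Y1 Y2
  ring

/-- `G₁ = H·B₁(n,i−1,k)·Y₁` (the `i`-certificate `R₁F`). [cite: LaiSprangZudilin2026, Lemma 5.2 (proof, p. 8: creative telescoping)] -/
def G1 (n i k : ℕ) : ℚ := hbar n i k * B1m n i k * Y1 n i k

/-- `G₂ = H·B₂(n,i,k−1)·Y₂` (the `k`-certificate `R₂F`). [cite: LaiSprangZudilin2026, Lemma 5.2 (proof, p. 8: creative telescoping)] -/
def G2 (n i k : ℕ) : ℚ := hbar n i k * B2m n i k * Y2 n i k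

/-- **Pointwise creative telescoping** at every lattice point of `ℕ³`:
`625·Σ_l E_l(n) F(n+l,i,k) = (G₁(n,i+1,k) − G₁(n,i,k)) + (G₂(n,i,k+1) − G₂(n,i,k))`.
[cite: LaiSprangZudilin2026, Lemma 5.2 (proof, p. 8: creative telescoping)] -/
theorem telescope_pointwise (n i k : ℕ) :
    625 * (E0 n * lszTerm n i k + E1 n * lszTerm (n + 1) i k + E2 n * lszTerm (n + 2) i k + E3 n * lszTerm (n + 3) i k)
      = (G1 n (i + 1) k - G1 n i k) + (G2 n i (k + 1) - G2 n i k) := by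
  have hk := key (n : ℚ) i k
  have ri := hbar_rel_i n i k
  have rk := hbar_rel_k n i k
  unfold G1 G2
  push_cast
  rw [hbar_rel₀ n i k, hbar_rel₁ n i k, hbar_rel₂ n i k, hbar_rel₃ n i k]
  linear_combination (hbar n i k) * hk - (Y1 (n : ℚ) ((i : ℚ) + 1) k) * ri
    - (Y2 (n : ℚ) (i : ℚ) ((k : ℚ) + 1)) * rk

/-- `G₁` vanishes on `i = 0`. [cite: LaiSprangZudilin2026, Lemma 5.2 (proof, p. 8: creative telescoping)] -/
theorem G1_zero_left (n k : ℕ) : G1 n 0 k = 0 := by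
  simp [G1, B1m]

/-- `G₁` vanishes past the support (`i > k`). [cite: LaiSprangZudilin2026, Lemma 5.2 (proof, p. 8: creative telescoping)] -/
theorem G1_of_lt {n i k : ℕ} (h : k < i) : G1 n i k = 0 := by
  simp [G1, hbar, lszTerm_of_lt_left h]

/-- `G₂` vanishes on `k = 0`. [cite: LaiSprangZudilin2026, Lemma 5.2 (proof, p. 8: creative telescoping)] -/
theorem G2_zero_right (n i : ℕ) : G2 n i 0 = 0 := by
  simp [G2, B2m]

/-- `G₂` vanishes past the support (`k > n+3`). [cite: LaiSprangZudilin2026, Lemma 5.2 (proof, p. 8: creative telescoping)] -/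
theorem G2_of_lt {n i k : ℕ} (h : n + 3 < k) : G2 n i k = 0 := by
  simp [G2, hbar, lszTerm_of_lt_right h]

/-! ## Summation: the order-three recurrence and its reduction to (eq:rec) -/

/-- **The certified order-three recurrence** `Σ_{l=0}^{3} E_l(n) ρ_{n+l} = 0` for all `n ≥ 0` (its telescoper is
`(2⁸(2n+5) − (2n+3)N)∘L`, `L` = (eq:rec)). [cite: LaiSprangZudilin2026, Lemma 5.2 (proof, p. 8: creative telescoping)] -/
theorem lszRho_order_three (n : ℕ) :
    E0 n * lszRho n + E1 n * lszRho (n + 1) + E2 n * lszRho (n + 2) + E3 n * lszRho (n + 3) = 0 := by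
  set N := n + 4 with hN
  have h0 : (lszRho n : ℚ) = ∑ i ∈ range N, ∑ k ∈ range N, lszTerm n i k := lszRho_eq_boxSum n N (by omega)
  have h1 : (lszRho (n + 1) : ℚ) = ∑ i ∈ range N, ∑ k ∈ range N, lszTerm (n + 1) i k :=
    lszRho_eq_boxSum (n + 1) N (by omega)
  have h2 : (lszRho (n + 2) : ℚ) = ∑ i ∈ range N, ∑ k ∈ range N, lszTerm (n + 2) i k :=
    lszRho_eq_boxSum (n + 2) N (by omega)
  have h3 : (lszRho (n + 3) : ℚ) = ∑ i ∈ range N, ∑ k ∈ range N, lszTerm (n + 3) i k :=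
    lszRho_eq_boxSum (n + 3) N (by omega)
  have hG1 : ∑ i ∈ range N, ∑ k ∈ range N, (G1 n (i + 1) k - G1 n i k) = 0 := by
    rw [Finset.sum_comm]
    refine Finset.sum_eq_zero fun k hk => ?_
    have hs := Finset.sum_range_sub (fun i => G1 n i k) N
    beta_reduce at hs
    rw [hs, G1_zero_left, G1_of_lt (Finset.mem_range.mp hk), sub_zero]
  have hG2 : ∑ i ∈ range N, ∑ k ∈ range N, (G2 n i (k + 1) - G2 n i k) = 0 := by
    refine Finset.sum_eq_zero fun i _ => ?_
    have hs := Finset.sum_range_sub (fun k => G2 n i k) N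
    beta_reduce at hs
    rw [hs, G2_zero_right, G2_of_lt (by omega), sub_zero]
  have htot : ∑ i ∈ range N, ∑ k ∈ range N,
      625 * (E0 n * lszTerm n i k + E1 n * lszTerm (n + 1) i k + E2 n * lszTerm (n + 2) i k + E3 n * lszTerm (n + 3) i k) = 0 := by
    rw [Finset.sum_congr rfl (fun i _ => Finset.sum_congr rfl (fun k _ => telescope_pointwise n i k))]
    simp only [Finset.sum_add_distrib]
    rw [hG1, hG2, add_zero]
  have hexp : ∑ i ∈ range N, ∑ k ∈ range N,
      625 * (E0 n * lszTerm n i k + E1 n * lszTerm (n + 1) i k + E2 n * lszTerm (n + 2) i k + E3 n * lszTerm (n + 3) i k)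
      = 625 * (E0 n * ∑ i ∈ range N, ∑ k ∈ range N, lszTerm n i k
          + E1 n * ∑ i ∈ range N, ∑ k ∈ range N, lszTerm (n + 1) i k
          + E2 n * ∑ i ∈ range N, ∑ k ∈ range N, lszTerm (n + 2) i k
          + E3 n * ∑ i ∈ range N, ∑ k ∈ range N, lszTerm (n + 3) i k) := by
    simp only [Finset.mul_sum, mul_add, Finset.sum_add_distrib]
  rw [h0, h1, h2, h3]
  have h := htot
  rw [hexp] at h
  linarith

/-- `L(n) = 2¹⁶(n+1)⁵ρ_n − M(n+1)ρ_{n+1} + (n+2)⁵ρ_{n+2}`: the operator of (eq:rec) applied at index `n+1`.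
[cite: LaiSprangZudilin2026, §1 (eq:rec)] -/
def L2 (n : ℕ) : ℚ :=
  2 ^ 16 * ((n : ℚ) + 1) ^ 5 * lszRho n - MQ ((n : ℚ) + 1) * lszRho (n + 1) + ((n : ℚ) + 2) ^ 5 * lszRho (n + 2)

/-- The order-three recurrence is `(2n+3)·L(n+1) = 2⁸(2n+5)·L(n)`.
[cite: LaiSprangZudilin2026, Lemma 5.2 (proof, p. 8: creative telescoping)] -/
theorem L2_succ (n : ℕ) : (2 * (n : ℚ) + 3) * L2 (n + 1) = 2 ^ 8 * (2 * (n : ℚ) + 5) * L2 n := by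
  have h := lszRho_order_three n
  have e12 : n + 1 + 1 = n + 2 := rfl
  have e13 : n + 1 + 2 = n + 3 := rfl
  unfold L2
  rw [e12, e13]
  unfold E0 E1 E2 E3 MQ at h
  unfold MQ
  push_cast at h ⊢
  linear_combination (-1 : ℚ) * h

/-- `L(0) = 0`: the printed initial data `ρ_0, ρ_1, ρ_2 = 1, 96, 14944`. [cite: LaiSprangZudilin2026, §1 (eq:rec)] -/
theorem L2_zero : L2 0 = 0 := by
  norm_num [L2, MQ, lszRho_zero, lszRho_one, lszRho_two]

/-- `L(n) = 0` for all `n`. [cite: LaiSprangZudilin2026, Lemma 5.2] -/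
theorem L2_eq_zero (n : ℕ) : L2 n = 0 := by
  induction n with
  | zero => exact L2_zero
  | succ m ih =>
    have h := L2_succ m
    rw [ih, mul_zero] at h
    have hne : (2 * (m : ℚ) + 3) ≠ 0 := by positivity
    exact (mul_eq_zero.mp h).resolve_left hne

end DoubleSumCT

open DoubleSumCT in
/-- **Lemma 5.2 (recursion half), DISCHARGED**: the double sum `ρ_n = lszRho n` satisfies (eq:rec)
`(n+1)⁵ρ_{n+1} + 2¹⁶n⁵ρ_{n−1} = 32(2n+1)(8n⁴+16n³+20n²+12n+3)ρ_n` for every `n ≥ 1`.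
[cite: LaiSprangZudilin2026, Lemma 5.2 and §1 (eq:rec)] -/
theorem recurrence_holds : recurrence := by
  intro n hn
  obtain ⟨m, rfl⟩ := Nat.exists_eq_add_of_le' hn
  have h := L2_eq_zero m
  unfold L2 at h
  rw [show m + 2 = m + 1 + 1 from rfl] at h
  rw [Nat.add_sub_cancel]
  have hmid : (recMid (m + 1) : ℚ) = MQ ((m : ℚ) + 1) := by
    rw [recMid_cast, Nat.cast_add, Nat.cast_one]
  have hq : ((m : ℚ) + 1 + 1) ^ 5 * (lszRho (m + 1 + 1) : ℚ) + 2 ^ 16 * ((m : ℚ) + 1) ^ 5 * (lszRho m : ℚ)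
      = (recMid (m + 1) : ℚ) * (lszRho (m + 1) : ℚ) := by
    rw [hmid]
    linear_combination h
  exact_mod_cast hq

end Literature.NumberTheory.Irrationality.LaiSprangZudilin2026
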